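import Summits.Ventures.PercRepro.RankLevelSetThroughMinor

/-! # RankLevelSetThroughMinorFive — THE PER-CIRCUIT INEQUALITY OF A TRIANGLE IS (↑) ON THE MINOR, AND THE EXACT
RESIDUE OF (★★) AT LEVEL `5` (night-1 g37; dossier §49; on `RankLevelSetThroughMinor`)

With the bijections of `RankLevelSetThroughMinor`, the per-circuit inequality of (★★) for the triangle `{y, a, b}`
at level `j` is EQUIVALENT to (↑) at `b` and level `j − 1` on the minor `M ／ y ＼ a`
(**`perCircuit_triangle_iff_upAt`**). That minor has `#E − 2` elements and nullity `≤ rk M✶ − 1`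
(`eRank_dual_contract_delete_add_one_le`), and `rk M✶ ≤ 5` as soon as the triangle has a member at level `5`; so
**`perElemAt_five_of_coloopFree_of_up_nullity`**: (★★) at level `5` on every coloop-free matroid at an element in no
parallel pair (`11 < #E`) follows from (↑) at level `4` at every element of every matroid of nullity `≤ 4` with
`≥ 10` elements — the exact residue of level `5` after `RankLevelSetPerElemNullityAll` (nullity `≤ 4` closed by
the chain) and `RankLevelSetPerElemFiveSeries` (no series triple). Every declaration has a docstring; imports: the
cell's own modules and Mathlib only. Axioms: standard. -/

namespace PercRepro

open Set Matroid

variable {α : Type} (M : Matroid α) [M.Finite]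

/-! ## The per-circuit inequality of a triangle is (↑) on the minor -/

/-- The minor `M ／ {y} ＼ {a}` has `#E − 2` elements. -/
lemma ncard_ground_contract_delete' {y a : α} (hyE : y ∈ M.E) (haE : a ∈ M.E) (hya : y ≠ a) :
    ((M.contract {y}).delete {a}).E.ncard = M.E.ncard - 2 := by
  rw [ground_contract_delete, Set.ncard_sdiff' (Set.pair_subset hyE haE) M.ground_finite, Set.ncard_pair hya]

/-- **THE PER-CIRCUIT INEQUALITY OF (★★) FOR A TRIANGLE `{y, a, b}` AT LEVEL `j` IS EXACTLY (↑) AT `b` AND LEVEL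
`j − 1` ON THE MINOR `M ／ y ＼ a`** (`1 ≤ j`, `2j + 1 < #E`). -/
theorem perCircuit_triangle_iff_upAt {y a b : α} (hK : M.IsCircuit {y, a, b}) (hya : y ≠ a) (hyb : y ≠ b)
    (hab : a ≠ b) {j : ℕ} (hj : 1 ≤ j) (hn : 2 * j + 1 < M.E.ncard) :
    ({Z ∈ lowAbsorbAt M y j | M.fundCircuit y Z = {y, a, b}}.ncard ≤
      {Q ∈ biIndep M (j + 1) | y ∈ Q ∧ ¬ M.Indep (insert y (M.E \ Q)) ∧
        M.fundCircuit y (M.E \ Q) = {y, a, b}}.ncard) ↔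
      BiIndepUpAt ((M.contract {y}).delete {a}) b (j - 1) := by
  have hyE : y ∈ M.E := hK.subset_ground (by simp)
  have haE : a ∈ M.E := hK.subset_ground (by simp)
  have hbE : b ∈ M.E := hK.subset_ground (by simp)
  haveI := contract_delete_finite M y a
  have hbN : b ∈ ((M.contract {y}).delete {a}).E := by
    rw [ground_contract_delete]
    exact ⟨hbE, by simp only [Set.mem_insert_iff, Set.mem_singleton_iff, not_or]; exact ⟨hyb.symm, hab.symm⟩⟩
  have hcard := ncard_ground_contract_delete' M hyE haE hya
  rw [members_triangle_ncard M hK hya hyb hab hj, targets_triangle_ncard M hK hya hyb hab (by omega),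
    upAt_iff_through_le_through _ hbN (by rw [hcard]; omega), hcard,
    show M.E.ncard - 2 - 1 - (j - 1) = M.E.ncard - j - 2 by omega]

omit [M.Finite] in
/-- **The dual rank of the minor `M ／ y ＼ a` is at most `rk M✶ − 1`** when `a` is not a coloop: a base `B` of
`(M ／ y ＼ a)✶ = M✶ ＼ y ／ a` gives the independent set `B ∪ {a}` of `M✶`. -/
theorem eRank_dual_contract_delete_add_one_le {y a : α} (hya : y ≠ a) (haE : a ∈ M.E) (ha : ¬ M.IsColoop a) :
    ((M.contract {y}).delete {a})✶.eRank + 1 ≤ M✶.eRank := by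
  obtain ⟨B, hB⟩ := ((M.contract {y}).delete {a})✶.exists_isBase
  rw [← hB.encard_eq_eRank]
  have hd : ((M.contract {y}).delete {a})✶ = (M✶.delete {y}).contract {a} := Matroid.dual_contract_delete M _ _
  rw [hd] at hB
  have hanl : M✶.IsNonloop a := by
    refine Matroid.isNonloop_of_not_isLoop (by rwa [Matroid.dual_ground]) ?_
    rwa [Matroid.dual_isLoop_iff_isColoop]
  have haI : (M✶.delete {y}).Indep {a} := by
    rw [Matroid.delete_indep_iff]
    exact ⟨hanl.indep, by simpa using hya.symm⟩
  rw [haI.contract_isBase_iff] at hB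
  obtain ⟨hBa, hdisj⟩ := hB
  have hind : M✶.Indep (B ∪ {a}) := (Matroid.delete_indep_iff.mp hBa.indep).1
  have haB : a ∉ B := fun h => Set.disjoint_left.mp hdisj h (by simp)
  have h1 : (B ∪ {a}).encard = B.encard + 1 := by
    rw [Set.union_singleton, Set.encard_insert_of_notMem haB]
  rw [← h1]
  exact hind.encard_le_eRank

/-- **(★★) AT LEVEL `5` ON A COLOOP-FREE MATROID AT AN ELEMENT IN NO PARALLEL PAIR, FROM (↑) AT LEVEL `4` ON
THE MINORS `M ／ y ＼ a` OF ITS TRIANGLES** (`11 < #E`): the circuits with `≥ 4` elements close under the chain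
(`perCircuit_le`), and a triangle class is (↑) on the minor. -/
theorem perElemAt_five_of_coloopFree_of_upAt (hcol : ∀ e, ¬ M.IsColoop e) {y : α} (hy : y ∈ M.E)
    (hnp : ∀ z, z ≠ y → y ∉ M.closure {z}) (hn : 2 * 5 + 1 < M.E.ncard)
    (hup : ∀ a b, M.IsCircuit {y, a, b} → y ≠ a → y ≠ b → a ≠ b → M✶.eRank ≤ 5 →
      BiIndepUpAt ((M.contract {y}).delete {a}) b 4) :
    {Z ∈ biIndep M 5 | y ∉ Z}.ncard ≤ {Q ∈ biIndep M 6 | y ∈ Q}.ncard := by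
  obtain ⟨z₀, hz₀⟩ : (M.E \ {y}).Nonempty := by
    rw [← Set.ncard_pos (M.ground_finite.subset Set.sdiff_subset), Set.ncard_sdiff_singleton_of_mem hy]
    omega
  have hz₀y : z₀ ≠ y := by simpa using hz₀.2
  refine perElemAt_of_perCircuit M hy 5 ?_
  intro Z₀ hZ₀
  have h3 := (fundCircuit_ncard_absorb M hy hnp hz₀y hZ₀).1
  rcases Nat.lt_or_ge 3 (M.fundCircuit y Z₀).ncard with h4 | h3'
  · exact perCircuit_le M hcol hy (by norm_num) hn hZ₀ (by omega)
  · -- the circuit is a triangle `{y, a, b}`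
    have hycl := mem_closure_of_mem_lowAbsorbAt' M hy hZ₀
    obtain ⟨-, -, -, -, -, hrank⟩ := absorb_dual_facts M hy hZ₀
    obtain ⟨⟨-, -, hZi, -⟩, hyZ, -⟩ := hZ₀
    have hC : M.IsCircuit (M.fundCircuit y Z₀) := hZi.fundCircuit_isCircuit hycl hyZ
    have hyK : y ∈ M.fundCircuit y Z₀ := M.mem_fundCircuit y Z₀
    have hKcard : (M.fundCircuit y Z₀).ncard = 3 := by omega
    have h2 : ((M.fundCircuit y Z₀) \ {y}).ncard = 2 := by
      rw [Set.ncard_sdiff_singleton_of_mem hyK, hKcard]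
    obtain ⟨a, b, hab, hS⟩ := Set.ncard_eq_two.mp h2
    have hKeq : M.fundCircuit y Z₀ = {y, a, b} := by
      rw [← Set.insert_sdiff_self_of_mem hyK, hS]
    have hya : y ≠ a := by
      intro h
      have : a ∈ (M.fundCircuit y Z₀) \ {y} := hS ▸ (by simp)
      exact this.2 (by simp [h])
    have hyb : y ≠ b := by
      intro h
      have : b ∈ (M.fundCircuit y Z₀) \ {y} := hS ▸ (by simp)
      exact this.2 (by simp [h])
    rw [hKeq] at hC ⊢
    exact (perCircuit_triangle_iff_upAt M hC hya hyb hab (by norm_num) hn).mpr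
      (hup a b hC hya hyb hab hrank)

/-- **THE EXACT RESIDUE OF LEVEL `5`: (★★) AT LEVEL `5` ON EVERY COLOOP-FREE MATROID AT AN ELEMENT IN NO PARALLEL
PAIR FOLLOWS FROM (↑) AT LEVEL `4` ON EVERY MATROID OF NULLITY `≤ 4` WITH `≥ 10` ELEMENTS** (`11 < #E`): the
minor `M ／ y ＼ a` of a triangle has `#E − 2` elements and nullity `≤ rk M✶ − 1 ≤ 4`. -/
theorem perElemAt_five_of_coloopFree_of_up_nullity (hcol : ∀ e, ¬ M.IsColoop e) {y : α} (hy : y ∈ M.E)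
    (hnp : ∀ z, z ≠ y → y ∉ M.closure {z}) (hn : 2 * 5 + 1 < M.E.ncard)
    (hup : ∀ (N : Matroid α) [N.Finite], N✶.eRank ≤ 4 → 10 ≤ N.E.ncard → ∀ b ∈ N.E, BiIndepUpAt N b 4) :
    {Z ∈ biIndep M 5 | y ∉ Z}.ncard ≤ {Q ∈ biIndep M 6 | y ∈ Q}.ncard := by
  refine perElemAt_five_of_coloopFree_of_upAt M hcol hy hnp hn ?_
  intro a b hK hya hyb hab hrank
  have haE : a ∈ M.E := hK.subset_ground (by simp)
  have hbE : b ∈ M.E := hK.subset_ground (by simp)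
  haveI := contract_delete_finite M y a
  have hbN : b ∈ ((M.contract {y}).delete {a}).E := by
    rw [ground_contract_delete]
    exact ⟨hbE, by simp only [Set.mem_insert_iff, Set.mem_singleton_iff, not_or]; exact ⟨hyb.symm, hab.symm⟩⟩
  have hcard := ncard_ground_contract_delete' M hy haE hya
  have h1 := eRank_dual_contract_delete_add_one_le M hya haE (hcol a)
  have h2 : ((M.contract {y}).delete {a})✶.eRank + 1 ≤ (4 : ℕ∞) + 1 := by
    rw [show (4 : ℕ∞) + 1 = 5 by norm_num]
    exact h1.trans hrank
  have h3 : ((M.contract {y}).delete {a})✶.eRank ≤ 4 := (WithTop.add_le_add_iff_right (by decide)).mp h2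
  exact hup _ h3 (by rw [hcard]; omega) b hbN

end PercRepro
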